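import Mathlib
import HarnessLib
import Summits.HubbardSuperconductivity.HubbardSuperconductivity.Theorems.KLProgrammeKLRegimeEngineTowerLevNumericsPins

/-!
# Route `KLProgramme` — crux K3 ENGINE (stmt-HubbardSuperconductivity-20437 `KLRegimeEngineV17F2`), stub (b) v2, THE WEIGHTED HALF «(b)-WT4», numerics side
# «part 4» (a) (cell gate-hubbard-kl, seat p4 g22): THE WEIGHTED KIT NAMES IN CLOSED FORM — the pins of W2/WB3/W10 (`W = 32c̄r/c̄c`, `Z = ε_x²c̄c²/8`,
# `σ = κ̄²/c̄c²`, `τ = 4e⁴κ̄²/c̄c²`, `ψ = c̄c²/κ̄²`, `Φ = e·ᾱ·c̄c/(κ̄²c̄r)`) under `κ̄ = √(2Cκe₀)`, `ᾱ = Ca·(M/β)`, `c̄r = 81·CJ·M/β`, `c̄c = 162·CJ·M/β`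

The weighted tower (k3c3-p2's W1–W10) and its block `0` (p3's WB2/WB3) use the kit names WITHOUT the `27`-track factors of the levels package; W10
(`kernelNormsWt4_all_klEng_structural`, p703207) asks the main tower's four names `κb αb crb ccb` only through DOMINANTS (`√(2Cκe₀) ≤ κb`, `Cb(M/β)4^d/e₀ ≤ αb`,
`81CJM/β ≤ crb`, `162CJM/β ≤ ccb`, for the link's `(Cκ, Cb, CJ)` AND the read-out's `(Cκr, Cbr, CJr)`), block `0`'s through EQUATIONS with `αb₀ = Cα·(M/β)`.
This file gives, for the generic equational pin system `κb = √(2Cκe₀)`, `αb = Ca·(M/β)`, `crb = 81CJM/β`, `ccb = 162CJM/β` (`Ca := Cb·4^d/e₀` for the main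
tower at the max-dominants, `Ca := Cα` for block `0`), the closed forms on the reduced variable `r := β/M`:
`W = 16`, `Z = (81CJ)²/8`, `σ = (2Cκe₀/(162²CJ²))·r²`, `τ = (4e⁴·2Cκe₀/(162²CJ²))·r²`, `ψ = (162²CJ²/(2Cκe₀))·r⁻²`, `Φ = (e·Ca/(Cκe₀))·r⁻¹`, `τψ = 4e⁴`,
`max 4 (2τψ) = 8e⁴`; and `levPinW_dominants`: the max-choices `Cκm = max Cκ Cκr`, `Cbm = max Cb Cbr`, `CJm = max CJ CJr` satisfy W10's eight dominants.
Pure real algebra; nothing about the model is asserted; nothing asserts (b), WT4, (ℓ), any stub, K3 or superconductivity.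
References: BGM 2006 §2.8 (2.83)–(2.84) [cite: BenfattoGiulianiMastropietro2006].
-/

noncomputable section

namespace Summit.HubbardSuperconductivity.HubbardSuperconductivity.Theorems.EngineV8

set_option linter.dupNamespace false -- summit = problem name (single-conjunct summit), D-0017

open Real Literature.MathematicalPhysics.QuantumLattice
open Summit.HubbardSuperconductivity.HubbardSuperconductivity.Theorems.KLRegimeSplit

section PinsW

variable {Cκ Ca CJ β : ℝ} {M : ℕ} {κb αb crb ccb W Z σ Φ ψ τ : ℝ}

/-- **`W = 16`** under the pins `crb = 81·CJ·M/β`, `ccb = 162·CJ·M/β` (`CJ, β, M ≠ 0`). [folklore] -/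
theorem levPinW_W (hCJ : CJ ≠ 0) (hβ : β ≠ 0) (hM : (M : ℝ) ≠ 0) (hcrb : crb = 81 * CJ * M / β) (hccb : ccb = 162 * CJ * M / β)
    (hW : W = 32 * crb / ccb) : W = 16 := by
  rw [hW, hcrb, hccb]; field_simp; norm_num

/-- **`Z = (81·CJ)²/8`** under the pin `ccb = 162·CJ·M/β` and `imagTimeWeight β M = β/(2M)` (`β, M ≠ 0`). [folklore] -/
theorem levPinW_Z (hβ : β ≠ 0) (hM : (M : ℝ) ≠ 0) (hccb : ccb = 162 * CJ * M / β) (hZ : Z = imagTimeWeight β M ^ 2 * ccb ^ 2 / 8) :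
    Z = (81 * CJ) ^ 2 / 8 := by
  rw [hZ, hccb, imagTimeWeight]; field_simp; ring

/-- **`σ = (2Cκe₀/(162²·CJ²))·(β/M)²`** under the pins. [folklore] -/
theorem levPinW_σ (hCκ : 0 < Cκ) (hCJ : CJ ≠ 0) (hβ : β ≠ 0) (hM : (M : ℝ) ≠ 0) (hκb : κb = Real.sqrt (2 * Cκ * klE0)) (hccb : ccb = 162 * CJ * M / β)
    (hσ : σ = κb ^ 2 / ccb ^ 2) : σ = 2 * Cκ * klE0 / (162 ^ 2 * CJ ^ 2) * (β / M) ^ 2 := by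
  obtain ⟨hκ2, _⟩ := levPin_κb_sq hCκ hκb
  rw [hσ, hκ2, hccb]; field_simp

/-- **`τ = (4e⁴·2Cκe₀/(162²·CJ²))·(β/M)²`** under the pins. [folklore] -/
theorem levPinW_τ (hCκ : 0 < Cκ) (hCJ : CJ ≠ 0) (hβ : β ≠ 0) (hM : (M : ℝ) ≠ 0) (hκb : κb = Real.sqrt (2 * Cκ * klE0)) (hccb : ccb = 162 * CJ * M / β)
    (hτ : τ = 4 * exp 4 * κb ^ 2 / ccb ^ 2) : τ = 4 * exp 4 * (2 * Cκ * klE0) / (162 ^ 2 * CJ ^ 2) * (β / M) ^ 2 := by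
  obtain ⟨hκ2, _⟩ := levPin_κb_sq hCκ hκb
  rw [hτ, hκ2, hccb]; field_simp

/-- **`ψ = (162²·CJ²/(2Cκe₀))·(M/β)²`** under the pins. [folklore] -/
theorem levPinW_ψ (hCκ : 0 < Cκ) (hCJ : CJ ≠ 0) (hβ : β ≠ 0) (hM : (M : ℝ) ≠ 0) (hκb : κb = Real.sqrt (2 * Cκ * klE0)) (hccb : ccb = 162 * CJ * M / β)
    (hψ : ψ = ccb ^ 2 / κb ^ 2) : ψ = 162 ^ 2 * CJ ^ 2 / (2 * Cκ * klE0) * ((M : ℝ) / β) ^ 2 := by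
  obtain ⟨hκ2, hκ0⟩ := levPin_κb_sq hCκ hκb
  have he : (0 : ℝ) < klE0 := by norm_num [klE0]
  rw [hψ, hκ2, hccb]; field_simp

/-- **`Φ = (e·Ca/(Cκ·e₀))·(M/β)`** under the pins with `αb = Ca·(M/β)`. [folklore] -/
theorem levPinW_Φ (hCκ : 0 < Cκ) (hCJ : CJ ≠ 0) (hβ : β ≠ 0) (hM : (M : ℝ) ≠ 0) (hκb : κb = Real.sqrt (2 * Cκ * klE0)) (hαb : αb = Ca * ((M : ℝ) / β))
    (hcrb : crb = 81 * CJ * M / β) (hccb : ccb = 162 * CJ * M / β) (hΦ : Φ = exp 1 * αb * ccb / (κb ^ 2 * crb)) :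
    Φ = exp 1 * Ca / (Cκ * klE0) * ((M : ℝ) / β) := by
  obtain ⟨hκ2, hκ0⟩ := levPin_κb_sq hCκ hκb
  have he : (klE0 : ℝ) ≠ 0 := by norm_num [klE0]
  rw [hΦ, hκ2, hαb, hcrb, hccb]; field_simp; ring

/-- **`τ·ψ = 4e⁴`** under the pins (`Cκ > 0`, `CJ, β, M ≠ 0`). [folklore] -/
theorem levPinW_τψ (hCκ : 0 < Cκ) (hCJ : CJ ≠ 0) (hβ : β ≠ 0) (hM : (M : ℝ) ≠ 0) (hκb : κb = Real.sqrt (2 * Cκ * klE0)) (hccb : ccb = 162 * CJ * M / β)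
    (hψ : ψ = ccb ^ 2 / κb ^ 2) (hτ : τ = 4 * exp 4 * κb ^ 2 / ccb ^ 2) : τ * ψ = 4 * exp 4 := by
  obtain ⟨hκ2, hκ0⟩ := levPin_κb_sq hCκ hκb
  have hccb0 : ccb ≠ 0 := by rw [hccb]; exact div_ne_zero (mul_ne_zero (mul_ne_zero (by norm_num) hCJ) hM) hβ
  rw [hτ, hψ]; field_simp

/-- **`max 4 (2τψ) = 8e⁴`** under the pins. [folklore] -/
theorem levPinW_ρ (hCκ : 0 < Cκ) (hCJ : CJ ≠ 0) (hβ : β ≠ 0) (hM : (M : ℝ) ≠ 0) (hκb : κb = Real.sqrt (2 * Cκ * klE0)) (hccb : ccb = 162 * CJ * M / β)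
    (hψ : ψ = ccb ^ 2 / κb ^ 2) (hτ : τ = 4 * exp 4 * κb ^ 2 / ccb ^ 2) : max 4 (2 * τ * ψ) = 8 * exp 4 := by
  rw [mul_assoc, levPinW_τψ hCκ hCJ hβ hM hκb hccb hψ hτ]
  refine (max_eq_right ?_).trans (by ring)
  have h4 : (1 : ℝ) ≤ exp 4 := Real.one_le_exp (by norm_num)
  linarith

end PinsW

/-! ## The max-dominants satisfy W10's eight inequalities -/

section Dominants

variable {Cκ Cb CJ Cκr Cbr CJr β : ℝ} {M d : ℕ}

/-- **THE MAX-DOMINANTS**: `κb := √(2·max Cκ Cκr·e₀)`, `αb := max Cb Cbr·(M/β)·4^d/e₀`, `crb := 81·max CJ CJr·M/β`, `ccb := 162·max CJ CJr·M/β` dominate both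
the link's and the read-out's pins (`0 < β`; no sign condition on the constants is needed). [folklore] -/
theorem levPinW_dominants (hβ : 0 < β) :
    Real.sqrt (2 * Cκ * klE0) ≤ Real.sqrt (2 * max Cκ Cκr * klE0) ∧
    Cb * ((M : ℝ) / β) * (4 : ℝ) ^ d / klE0 ≤ max Cb Cbr * ((M : ℝ) / β) * (4 : ℝ) ^ d / klE0 ∧
    81 * CJ * M / β ≤ 81 * max CJ CJr * M / β ∧ 162 * CJ * M / β ≤ 162 * max CJ CJr * M / β ∧
    Real.sqrt (2 * Cκr * klE0) ≤ Real.sqrt (2 * max Cκ Cκr * klE0) ∧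
    Cbr * ((M : ℝ) / β) * (4 : ℝ) ^ d / klE0 ≤ max Cb Cbr * ((M : ℝ) / β) * (4 : ℝ) ^ d / klE0 ∧
    81 * CJr * M / β ≤ 81 * max CJ CJr * M / β ∧ 162 * CJr * M / β ≤ 162 * max CJ CJr * M / β := by
  have he : (0 : ℝ) < klE0 := by norm_num [klE0]
  have hM : (0 : ℝ) ≤ M := Nat.cast_nonneg M
  have h1 : Cκ ≤ max Cκ Cκr := le_max_left _ _
  have h2 : Cκr ≤ max Cκ Cκr := le_max_right _ _
  have h3 : Cb ≤ max Cb Cbr := le_max_left _ _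
  have h4 : Cbr ≤ max Cb Cbr := le_max_right _ _
  have h5 : CJ ≤ max CJ CJr := le_max_left _ _
  have h6 : CJr ≤ max CJ CJr := le_max_right _ _
  refine ⟨Real.sqrt_le_sqrt (by gcongr), by gcongr, by gcongr, by gcongr, Real.sqrt_le_sqrt (by gcongr), by gcongr, by gcongr, by gcongr⟩

end Dominants

end Summit.HubbardSuperconductivity.HubbardSuperconductivity.Theorems.EngineV8

end
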